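import Literature.NumberTheory.GaloisRepresentations.LubinTateUnramifiedTraceCoherentNormalBasis
import HarnessLib

/-!
# Normal-basis coordinates along an unramified tower: `lim←_{Tr} 𝒪_{E_m} ≅ Λ(Gal(E_∞/F), 𝒪_F)` — the trace becomes the push-forward of
# `𝒪_F`-valued functions on the finite Galois groups, and the Galois action becomes translation

De Shalit, *Iwasawa theory of elliptic curves with complex multiplication* (1987), Ch. I §3.1 ("`Λ(G, M) = lim← M[G/H] = M⟦G⟧`"), §3.8
(16)–(17) and §3.14 (end of the proof of Theorem 3.7: "Since `k′/k` is unramified … `Ker(j) = 𝒪′ ⊗ 𝓛`"; Ch. III §1.3 for the semi-local version): the coordinate modules `𝒪_{k′}⟦Y⟧` of Theorem I.3.7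
over the unramified layers `k′ = E_m` form an inverse system under the TRACES, and the structure of its limit as a module over the
completed group ring is read off trace-coherent integral normal bases (`exists_traceCoherent_isIntegralNormalGen`).  In the coordinates
`x = Σ_σ a_x(σ)·σθ_m` (`a_x : Gal(E_m/F) → 𝒪_F`, `IsIntegralNormalGen.basis`):

* ★ `IsIntegralNormalGen.repr_unitBallEquiv` — `a_{τx}(σ) = a_x(τ⁻¹σ)`: the Galois action is left TRANSLATION of functions;
* ★★ `IsIntegralNormalGen.repr_unitBallTrace` — for `E₁ ≤ E₂` and `θ₁ = Tr θ₂`: `a_{Tr x}(ρ) = Σ_{σ|_{E₁} = ρ} a_x(σ)`: the trace is the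
  PUSH-FORWARD of functions along `Gal(E₂/F) ↠ Gal(E₁/F)` (the distribution relation of de Shalit's `Λ(G, M) = lim← M[G/H]`, the
  tree's `GroupDistribution` currency);
* ★★ `traceCoherent_iff_pushforward` — along a tower with trace-coherent generators `θ`, a family `(x_m ∈ 𝒪_{E_m})` is trace-coherent iff
  its coordinate functions are push-forward-coherent; ★ `exists_unique_traceCoherent_of_pushforward` — every push-forward-coherent family
  of functions `(a_m : Gal(E_m/F) → 𝒪_F)` is the coordinate family of a unique trace-coherent `(x_m)`.  Hence
  **`lim←_{Tr} 𝒪_{E_m} ≅ lim←_m 𝒪_F[Gal(E_m/F)] = Λ(Gal(E_∞/F), 𝒪_F)`**, `𝒪_F`-linearly and Galois-equivariantly (and coefficientwise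
  `lim←_{Tr} 𝒪_{E_m}⟦Y⟧ ≅ Λ(Gal(E_∞/F), 𝒪_F)⟦Y⟧`): the unramified half of the `Λ`-structure of the coordinate module of brick (c).

Everything PROVED (0 sorry, no named facts, no new definitions).

## References

* E. de Shalit, *Iwasawa theory of elliptic curves with complex multiplication* (1987), Ch. I §3.1, §3.8 (16)–(17), §3.14; Ch. III §1.3. [deShalit1987]
* J.-P. Serre, *Local Fields* (1979), Ch. I §4 Prop. 10. [SerreLocalFields1979]
-/

noncomputable section

namespace Literature.NumberTheory.GaloisRepresentations

section UnramifiedTowerCoordinates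

open GaloisRepresentations.IsNonarchimedeanLocalField LubinTate ValuativeRel Field

variable {F : Type} [Field F] [ValuativeRel F] [TopologicalSpace F] [IsNonarchimedeanLocalField F]

attribute [local instance] ltNormUniformSpace ltNormIsUniformAddGroup rk1 nF nE fintypeResidueField

variable {π : 𝒪[F]} (hπ : (valuation F).IsUniformizer (π : F))

/-! ### One level: the Galois action is translation -/

variable {E : IntermediateField F (AlgebraicClosure F)} [FiniteDimensional F E] [IsGalois F E]

/-- ★ **In normal-basis coordinates the Galois action is left translation**: if `x = Σ_σ a(σ)·σθ` then `τx = Σ_σ a(τ⁻¹σ)·σθ`.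
[cite: deShalit1987, Ch. I §3.1] -/
theorem IsIntegralNormalGen.repr_unitBallEquiv {θ : unitBall E} (hθ : IsIntegralNormalGen E θ) (τ : E ≃ₐ[F] E) (x : unitBall E)
    (σ : E ≃ₐ[F] E) : hθ.basis.repr (unitBallEquiv E τ x) σ = hθ.basis.repr x (τ⁻¹ * σ) := by
  classical
  have e : unitBallEquiv E τ x = ∑ σ, hθ.basis.repr x (τ⁻¹ * σ) • hθ.basis σ := by
    conv_lhs => rw [← hθ.basis.sum_repr x]
    rw [map_sum]
    symm
    refine Fintype.sum_equiv (Equiv.mulLeft τ⁻¹) _ _ fun ρ => ?_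
    rw [Equiv.coe_mulLeft, unitBallEquiv_smul, hθ.basis_apply, hθ.basis_apply, ← unitBallEquiv_mul_apply, mul_inv_cancel_left]
  rw [e]
  exact congrFun (hθ.basis.repr_sum_self fun σ => hθ.basis.repr x (τ⁻¹ * σ)) σ

/-! ### Two levels: the trace is the push-forward -/

variable {E₁ E₂ : IntermediateField F (AlgebraicClosure F)} [FiniteDimensional F E₁] [FiniteDimensional F E₂] [IsGalois F E₁] [IsGalois F E₂]

/-- ★★ **In normal-basis coordinates the trace is the push-forward along `Gal(E₂/F) ↠ Gal(E₁/F)`**: for `E₁ ≤ E₂`, a normal integral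
generator `θ` of `𝒪_{E₂}` and the generator `Tr θ` of `𝒪_{E₁}`, if `x = Σ_σ a(σ)·σθ` then `Tr x = Σ_ρ (Σ_{σ|_{E₁} = ρ} a(σ))·ρ(Tr θ)`.
[cite: deShalit1987, Ch. I §3.1, §3.8 (16)] -/
theorem IsIntegralNormalGen.repr_unitBallTrace (h : E₁ ≤ E₂) {θ : unitBall E₂} (hθ : IsIntegralNormalGen E₂ θ) (x : unitBall E₂)
    (ρ : E₁ ≃ₐ[F] E₁) :
    open scoped Classical in
    (hθ.unitBallTrace h).basis.repr (GaloisRepresentations.unitBallTrace h x) ρ =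
      ∑ σ ∈ Finset.univ.filter (fun σ : E₂ ≃ₐ[F] E₂ => towerRestrict h σ = ρ), hθ.basis.repr x σ := by
  classical
  have e : GaloisRepresentations.unitBallTrace h x =
      ∑ ρ, (∑ σ ∈ Finset.univ.filter (fun σ : E₂ ≃ₐ[F] E₂ => towerRestrict h σ = ρ), hθ.basis.repr x σ) • (hθ.unitBallTrace h).basis ρ := by
    conv_lhs => rw [← hθ.basis.sum_repr x]
    rw [map_sum, ← Finset.sum_fiberwise Finset.univ (towerRestrict h)
      (fun σ => GaloisRepresentations.unitBallTrace h (hθ.basis.repr x σ • hθ.basis σ))]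
    refine Finset.sum_congr rfl fun ρ _ => ?_
    rw [Finset.sum_smul]
    refine Finset.sum_congr rfl fun σ hσ => ?_
    rw [Finset.mem_filter] at hσ
    rw [map_smul, hθ.basis_apply, (hθ.unitBallTrace h).basis_apply, unitBallTrace_unitBallEquiv, hσ.2]
  rw [e]
  exact congrFun ((hθ.unitBallTrace h).basis.repr_sum_self fun ρ =>
    ∑ σ ∈ Finset.univ.filter (fun σ : E₂ ≃ₐ[F] E₂ => towerRestrict h σ = ρ), hθ.basis.repr x σ) ρ

/-- **Two elements with the same coordinates are equal** (restated for convenience). [cite: SerreLocalFields1979, Ch. I §4 Prop. 10] -/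
theorem IsIntegralNormalGen.eq_of_repr_eq {θ : unitBall E₁} (hθ : IsIntegralNormalGen E₁ θ) {x y : unitBall E₁}
    (h : ∀ σ, hθ.basis.repr x σ = hθ.basis.repr y σ) : x = y :=
  hθ.basis.repr.injective (Finsupp.ext h)

/-! ### Along a tower: `lim←_{Tr} 𝒪_{E_m}` in coordinates -/

variable (E : ℕ → IntermediateField F (AlgebraicClosure F)) [∀ m, FiniteDimensional F (E m)] [∀ m, IsGalois F (E m)]
  (hmono : Monotone E)

/-- ★★ **Trace-coherence ⟺ push-forward-coherence of the coordinates**: along a tower `E₀ ≤ E₁ ≤ ⋯` with trace-coherent normal integral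
generators `θ_m` (`Tr θ_{m+1} = θ_m`, `exists_traceCoherent_isIntegralNormalGen`), a family `x_m ∈ 𝒪_{E_m}` satisfies `Tr x_{m+1} = x_m`
for all `m` iff its coordinate functions `a_m = a_{x_m} : Gal(E_m/F) → 𝒪_F` satisfy `a_m(ρ) = Σ_{σ|_{E_m} = ρ} a_{m+1}(σ)` for all `m, ρ` —
i.e. `lim←_{Tr} 𝒪_{E_m}` is identified with the compatible families in `lim←_m 𝒪_F[Gal(E_m/F)] = Λ(Gal(E_∞/F), 𝒪_F)`.
[cite: deShalit1987, Ch. I §3.1, §3.8 (16)–(17), §3.14] -/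
theorem traceCoherent_iff_pushforward {θ : ∀ m, unitBall (E m)} (hθ : ∀ m, IsIntegralNormalGen (E m) (θ m))
    (hcoh : ∀ m, unitBallTrace (hmono (Nat.le_succ m)) (θ (m + 1)) = θ m) (x : ∀ m, unitBall (E m)) :
    open scoped Classical in
    (∀ m, unitBallTrace (hmono (Nat.le_succ m)) (x (m + 1)) = x m) ↔
      ∀ m (ρ : E m ≃ₐ[F] E m), (hθ m).basis.repr (x m) ρ =
        ∑ σ ∈ Finset.univ.filter (fun σ : E (m + 1) ≃ₐ[F] E (m + 1) => towerRestrict (hmono (Nat.le_succ m)) σ = ρ),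
          (hθ (m + 1)).basis.repr (x (m + 1)) σ := by
  classical
  -- the basis of level `m` generated by `Tr θ_{m+1}` IS the basis generated by `θ_m`
  have hb : ∀ m, ((hθ (m + 1)).unitBallTrace (hmono (Nat.le_succ m))).basis = (hθ m).basis := by
    intro m
    exact Module.Basis.eq_of_apply_eq fun ρ => by rw [IsIntegralNormalGen.basis_apply, IsIntegralNormalGen.basis_apply, hcoh]
  constructor
  · intro hx m ρ
    rw [← hx m, ← hb m]
    exact (hθ (m + 1)).repr_unitBallTrace (hmono (Nat.le_succ m)) (x (m + 1)) ρ
  · intro ha m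
    refine (hθ m).eq_of_repr_eq fun ρ => ?_
    rw [ha m ρ, ← hb m]
    exact (hθ (m + 1)).repr_unitBallTrace (hmono (Nat.le_succ m)) (x (m + 1)) ρ

/-- ★ **Every compatible family of functions is the coordinate family of a unique trace-coherent family**: for `𝒪_F`-valued functions
`a_m` on `Gal(E_m/F)` with `a_m(ρ) = Σ_{σ|_{E_m} = ρ} a_{m+1}(σ)` there is a unique `x = (x_m)` with `Tr x_{m+1} = x_m` and coordinates
`a` — the inverse of `lim←_{Tr} 𝒪_{E_m} → Λ(Gal(E_∞/F), 𝒪_F)`. [cite: deShalit1987, Ch. I §3.1, §3.8 (17)] -/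
theorem exists_unique_traceCoherent_of_pushforward {θ : ∀ m, unitBall (E m)} (hθ : ∀ m, IsIntegralNormalGen (E m) (θ m))
    (hcoh : ∀ m, unitBallTrace (hmono (Nat.le_succ m)) (θ (m + 1)) = θ m) (a : ∀ m, (E m ≃ₐ[F] E m) → 𝒪[F])
    (ha : open scoped Classical in ∀ m (ρ : E m ≃ₐ[F] E m), a m ρ =
      ∑ σ ∈ Finset.univ.filter (fun σ : E (m + 1) ≃ₐ[F] E (m + 1) => towerRestrict (hmono (Nat.le_succ m)) σ = ρ), a (m + 1) σ) :
    ∃! x : ∀ m, unitBall (E m), (∀ m, unitBallTrace (hmono (Nat.le_succ m)) (x (m + 1)) = x m) ∧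
      ∀ m σ, (hθ m).basis.repr (x m) σ = a m σ := by
  classical
  have hrepr : ∀ m σ, (hθ m).basis.repr (∑ τ, a m τ • (hθ m).basis τ) σ = a m σ :=
    fun m σ => congrFun ((hθ m).basis.repr_sum_self (a m)) σ
  refine ⟨fun m => ∑ τ, a m τ • (hθ m).basis τ, ⟨?_, hrepr⟩, ?_⟩
  · refine (traceCoherent_iff_pushforward E hmono hθ hcoh (fun m => ∑ τ, a m τ • (hθ m).basis τ)).mpr fun m ρ => ?_
    simp only [hrepr]
    exact ha m ρ
  · rintro y ⟨-, hy⟩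
    funext m
    exact (hθ m).eq_of_repr_eq fun σ => by rw [hy, hrepr]

end UnramifiedTowerCoordinates

end Literature.NumberTheory.GaloisRepresentations
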